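import Mathlib
import Summits.Ventures.PercRepro2.Defs
import Summits.Ventures.PercRepro2.Independence
import Summits.Ventures.PercRepro2.Harris
import Summits.Ventures.PercRepro2.Graph
import Summits.Ventures.PercRepro2.Exploration
import Summits.Ventures.PercRepro2.Events
import Summits.Ventures.PercRepro2.HCov
import Summits.Ventures.PercRepro2.HCovFns
import Summits.Ventures.PercRepro2.HCovSwap
import Summits.Ventures.PercRepro2.PendantRoot
import Summits.Ventures.PercRepro2.PendantO
import Summits.Ventures.PercRepro2.PendantB
import Summits.Ventures.PercRepro2.PendantBRow
import Summits.Ventures.PercRepro2.LeafStep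
import Summits.Ventures.PercRepro2.LeafStepT0
import Summits.Ventures.PercRepro2.LeafChain
import Summits.Ventures.PercRepro2.LeafEnds
import Summits.Ventures.PercRepro2.LeafPlus

/-!
# `(HCOV)⁺` at the four marked ends
(blind cell PercRepro2, p1 g8; `proofs/P1-LEAFPLUS.md` §2(d))

`LeafPlus` shows that the triple **`(HCOV) ∧ (LEAF) ∧ (Q1)`** propagates from an attachment vertex
`x` to a leaf `v` at `x` with no side condition: (HCOV) and (LEAF) by `LeafChain`, (Q1) by
`Q1Row_leaf` (`HCovTriple_of_leaf`). Here the triple is established at the four MARKED ends: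

* `x = a₂` (or `a₁`): `Gc = 0`, `R½ = P(Z_L + W_L)` (`LeafEnds`) and `CovC(o, a₂) = 0`, so (Q1) is
  `0 ≤ 0` (`Q1Row_root`, `Q1Row_root'` by `Gc_swap`);
* `x = o`: `Gc = 0` and `CovC(o, o) = P(Q, o ∈ U)·P(Q, o ∉ U) ≥ 0` (`Q1Row_o`);
* `x = b`: **`P(Q)² · Gc(o, b, b) + CovC(o, b) · T₀(b, b) = P(Q) · P(Q, b ∉ U) ·
  [4 (bL·Z_L + bH·Z_H) + 2 P(Q) (Y_L + Y_H)] ≥ 0`** (`Q1Row_b`) — an exact identity over the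
  landed BHK 1.4 slacks `Z_L, Z_H` (`bhk_cross_cluster`) and `Y_L, Y_H` (`bhk_cross_cluster_avoid`,
  the slacks of `PendantBRow`), found by an exact simplex over `{degree-2 monomial × slack}`
  (`mining/p1/g8/q1b.py`); here `CovC(o, b) = W_L + W_H − Z_L − Z_H`, `T₀(b, b) = 4 P(Q) bL bH`.

Hence the triple holds at every leaf attached to a marked vertex; the composition over longer
pendant paths (where the intermediate vertices have degree two) is `LeafDelete.lean`, which removes
the outer leaf by re-pointing its edge — the naive composition of two leaf hypotheses in one graph
is inconsistent (`LeafDelete.pendant_path_hyps_absurd`).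
-/

namespace Summit.Ventures.PercRepro2

open UnionCluster CovForm PendantRoot PendantO

namespace LeafStep

variable {V : Type*} {E : Type*} [Fintype E] [DecidableEq E] [Fintype V] [DecidableEq V]
  {R : Type*} [Field R] [LinearOrder R] [IsStrictOrderedRing R]

variable (p : E → R) (ends : E → Sym2 V)

/-! ## (Q1) at the marked ends -/

omit [Fintype E] [DecidableEq E] [Fintype V] [DecidableEq V] [LinearOrder R] [IsStrictOrderedRing R] in
/-- Under `Q` the roots are not connected: `Q ∩ (X ∩ {a₁ ↔ a₂}) = ∅`. -/
lemma Q_X_conn_roots (a₁ a₂ : V) (X : Set (Config E)) :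
    avoidAll ends a₂ {a₁} ∩ (X ∩ connEvent ends a₁ a₂) = ∅ := by
  rw [Set.inter_comm X]
  exact Q_inter_conn_roots ends a₁ a₂ X

omit [Fintype V] [DecidableEq V] [LinearOrder R] [IsStrictOrderedRing R] in
/-- `CovC(o, a₂) = 0` (the root is surely in `U`). -/
lemma covC_root (o a₁ a₂ : V) : covC p ends o a₁ a₂ a₂ = 0 := by
  unfold covC mUU mU
  simp only [connEvent_self, Set.inter_univ, Q_X_conn_roots, Q_inter_conn_roots₂, prob_empty]
  ring

omit [Fintype V] in
/-- **(Q1) at the degenerate marking `a₃ = a₂`** (both terms vanish). -/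
theorem Q1Row_root (o a₁ a₂ b : V) : Q1Row p ends o a₁ a₂ a₂ b := by
  unfold Q1Row
  rw [Gc_root, covC_root]
  simp

omit [Fintype V] [DecidableEq V] [LinearOrder R] [IsStrictOrderedRing R] in
/-- `Q` is symmetric in the roots, so `mU`, `mUU` and `covC` are. -/
lemma covC_swap (o a₁ a₂ v : V) : covC p ends o a₂ a₁ v = covC p ends o a₁ a₂ v := by
  unfold covC mUU mU
  rw [avoidAll_root_swap]
  ring

omit [Fintype V] [DecidableEq V] [LinearOrder R] [IsStrictOrderedRing R] in
/-- `T₀` is symmetric in the roots (a special case of `Gc_swap` in the `a₃`-free form). -/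
lemma T0_swap (o a₁ a₂ b : V) : T0 p ends o a₂ a₁ b = T0 p ends o a₁ a₂ b := by
  unfold T0 EQbo EQo mU mUU gap
  rw [avoidAll_root_swap]
  ring

omit [Fintype V] [DecidableEq V] [IsStrictOrderedRing R] in
/-- (Q1) is symmetric in the roots. -/
theorem Q1Row_swap (o a₁ a₂ a₃ b : V) :
    Q1Row p ends o a₂ a₁ a₃ b ↔ Q1Row p ends o a₁ a₂ a₃ b := by
  unfold Q1Row
  rw [Gc_swap, covC_swap, T0_swap, avoidAll_root_swap]

omit [Fintype V] in
/-- **(Q1) at the degenerate marking `a₃ = a₁`.** -/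
theorem Q1Row_root' (o a₁ a₂ b : V) : Q1Row p ends o a₁ a₂ a₁ b :=
  (Q1Row_swap p ends o a₁ a₂ a₁ b).1 (Q1Row_root p ends o a₂ a₁ b)

omit [Fintype V] [DecidableEq V] [LinearOrder R] [IsStrictOrderedRing R] in
/-- `CovC(o, o) = P(Q, o ∈ U) · P(Q, o ∉ U)`. -/
lemma covC_self (o a₁ a₂ : V) :
    covC p ends o a₁ a₂ o =
      mU p ends a₁ a₂ o * (prob p (avoidAll ends a₂ {a₁}) - mU p ends a₁ a₂ o) := by
  unfold covC mUU mU
  simp only [Set.inter_self, Q_inter_both_eq_empty₂, Q_inter_both_eq_empty₂', prob_empty]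
  ring

/-- **(Q1) at the degenerate marking `a₃ = o`**: `Gc(o) = 0` and `CovC(o, o) ≥ 0`. -/
theorem Q1Row_o (hp : IsProbVec p) (o a₁ a₂ b : V) : Q1Row p ends o a₁ a₂ o b := by
  unfold Q1Row
  rw [Gc_o, covC_self]
  have hT := T0_nonneg p ends hp b a₁ a₂ o
  have hm : 0 ≤ mU p ends a₁ a₂ o := by
    unfold mU
    exact add_nonneg (prob_nonneg hp _) (prob_nonneg hp _)
  have hD : 0 ≤ prob p (avoidAll ends a₂ {a₁}) - mU p ends a₁ a₂ o := by
    have h := prob_PD_v p ends a₁ a₂ o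
    have hPD := prob_nonneg hp (PDEvent ends a₁ a₂ o)
    unfold mU
    linarith
  have := mul_nonneg (mul_nonneg hm hD) hT
  simp only [mul_zero, zero_add]
  exact this

/-- **(Q1) at the degenerate marking `a₃ = b`** — the identity
`P(Q)² Gc(o,b,b) + CovC(o,b) T₀(b,b) = P(Q)·P(Q, b ∉ U)·[4(bL Z_L + bH Z_H) + 2 P(Q)(Y_L + Y_H)]`
over the four landed BHK slacks. -/
theorem Q1Row_b (hp : IsProbVec p) (o a₁ a₂ b : V) : Q1Row p ends o a₁ a₂ b b := by
  unfold Q1Row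
  rw [Gc_b]
  unfold covC T0 EQbo EQo mUU mU
  rw [gap_eq_Q]
  simp only [Set.inter_self, Q_inter_both_eq_empty₂, Q_inter_both_eq_empty₂', prob_empty]
  have hZL := PendantB.ZL_nonneg p ends hp o a₁ a₂ b
  have hZH := PendantB.ZH_nonneg p ends hp o a₁ a₂ b
  have hYL := PendantB.YL_nonneg p ends hp o a₁ a₂ b
  have hYH := PendantB.YH_nonneg p ends hp o a₁ a₂ b
  have hsum := PendantB.bL_add_bH_le p ends hp a₁ a₂ b
  have hP := prob_nonneg hp (avoidAll ends a₂ {a₁})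
  have hbL := prob_nonneg hp (avoidAll ends a₂ {a₁} ∩ connEvent ends a₁ b)
  have hbH := prob_nonneg hp (avoidAll ends a₂ {a₁} ∩ connEvent ends a₂ b)
  generalize prob p (avoidAll ends a₂ {a₁}) = P at hZL hZH hYL hYH hsum hP ⊢
  generalize prob p (avoidAll ends a₂ {a₁} ∩ connEvent ends a₁ b) = bL at hZH hYL hYH hsum hbL ⊢
  generalize prob p (avoidAll ends a₂ {a₁} ∩ connEvent ends a₂ b) = bH at hZL hYL hYH hsum hbH ⊢
  generalize prob p (avoidAll ends a₂ {a₁} ∩ connEvent ends a₁ o) = oL at hZL hYL ⊢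
  generalize prob p (avoidAll ends a₂ {a₁} ∩ connEvent ends a₂ o) = oH at hZH hYH ⊢
  generalize prob p (avoidAll ends a₂ {a₁} ∩ (connEvent ends a₁ o ∩ connEvent ends a₁ b)) = A at hYL ⊢
  generalize prob p (avoidAll ends a₂ {a₁} ∩ (connEvent ends a₂ o ∩ connEvent ends a₂ b)) = B at hYH ⊢
  generalize prob p (avoidAll ends a₂ {a₁} ∩ (connEvent ends a₂ o ∩ connEvent ends a₁ b)) = C at hZH hYH ⊢
  generalize prob p (avoidAll ends a₂ {a₁} ∩ (connEvent ends a₁ o ∩ connEvent ends a₂ b)) = Dd at hZL hYL ⊢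
  have hD : 0 ≤ P - bL - bH := by linarith
  have t1 := mul_nonneg (mul_nonneg (mul_nonneg hP hD) hbL) (sub_nonneg.2 hZL)
  have t2 := mul_nonneg (mul_nonneg (mul_nonneg hP hD) hbH) (sub_nonneg.2 hZH)
  have t3 := mul_nonneg (mul_nonneg (mul_nonneg hP hD) hP) (sub_nonneg.2 hYL)
  have t4 := mul_nonneg (mul_nonneg (mul_nonneg hP hD) hP) (sub_nonneg.2 hYH)
  nlinarith [t1, t2, t3, t4]

/-! ## The leaf-closed triple -/

/-- **`(HCOV) ∧ (LEAF) ∧ (Q1)`** at a marking — the triple that propagates along leaves with no side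
condition. -/
def HCovTriple (o a₁ a₂ a₃ b : V) : Prop :=
  HCov p ends o a₁ a₂ a₃ b ∧ LeafRow p ends o a₁ a₂ a₃ b ∧ Q1Row p ends o a₁ a₂ a₃ b

/-- **The triple propagates down a pendant edge**: the triple at `w` gives the triple at a leaf `v`
attached to `w` (no side condition: (HCOV) and (LEAF) by `LeafChain`, (Q1) by `Q1Row_leaf`). -/
theorem HCovTriple_of_leaf (hp : IsProbVec p) {g : E} {v w : V} (hg : ends g = s(v, w))
    (hleaf : ∀ e, v ∈ ends e → e = g) (hvw : v ≠ w) {o a₁ a₂ b : V} (hv1 : v ≠ a₁) (hv2 : v ≠ a₂)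
    (ho : o ≠ v) (hb : b ≠ v) (hw : HCovTriple p ends o a₁ a₂ w b) :
    HCovTriple p ends o a₁ a₂ v b := by
  obtain ⟨hH, hR, hQ⟩ := hw
  refine ⟨HCov_of_leaf p ends hp hg hleaf hvw hv1 hv2 ho hb hH hR,
    leafRow_of_leaf p ends hp hg hleaf hvw hv1 hv2 ho hb hR, ?_⟩
  exact Q1Row_leaf p ends hp hg hleaf hvw hv1 hv2 ho hb (T0_nonneg p ends hp o a₁ a₂ b) hR hQ

/-- The triple at the marked end `o`. -/
theorem HCovTriple_o (hp : IsProbVec p) (o a₁ a₂ b : V) : HCovTriple p ends o a₁ a₂ o b :=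
  ⟨HCov_o p ends o a₁ a₂ b, leafRow_o p ends hp o a₁ a₂ b, Q1Row_o p ends hp o a₁ a₂ b⟩

/-- The triple at the marked end `b`. -/
theorem HCovTriple_b (hp : IsProbVec p) (o a₁ a₂ b : V) : HCovTriple p ends o a₁ a₂ b b :=
  ⟨HCov_b p ends hp o a₁ a₂ b, leafRow_b p ends hp o a₁ a₂ b, Q1Row_b p ends hp o a₁ a₂ b⟩

/-- The triple at the root `a₂`. -/
theorem HCovTriple_root (hp : IsProbVec p) (o a₁ a₂ b : V) : HCovTriple p ends o a₁ a₂ a₂ b :=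
  ⟨HCov_root p ends o a₁ a₂ b, leafRow_root p ends hp o a₁ a₂ b, Q1Row_root p ends o a₁ a₂ b⟩

omit [Fintype V] [DecidableEq V] in
/-- `R½` is symmetric in the roots. -/
lemma Rhalf_swap (o a₁ a₂ v b : V) : Rhalf p ends o a₂ a₁ v b = Rhalf p ends o a₁ a₂ v b := by
  unfold Rhalf T0 Gc1 mU mUU
  unfold EQbo EQb3 EQb3o EQo EQ3 EQ3o PDb PDbo Do gap
  rw [avoidAll_root_swap, PDEvent_root_swap]
  ring

omit [Fintype V] [DecidableEq V] in
/-- The leaf row is symmetric in the roots. -/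
theorem leafRow_swap (o a₁ a₂ v b : V) :
    LeafRow p ends o a₂ a₁ v b ↔ LeafRow p ends o a₁ a₂ v b := by
  unfold LeafRow
  rw [Rhalf_swap]

/-- The triple at the root `a₁`. -/
theorem HCovTriple_root' (hp : IsProbVec p) (o a₁ a₂ b : V) : HCovTriple p ends o a₁ a₂ a₁ b :=
  ⟨(HCov_swap p ends o a₁ a₂ a₁ b).1 (HCov_root p ends o a₂ a₁ b),
    (leafRow_swap p ends o a₁ a₂ a₁ b).1 (leafRow_root p ends hp o a₂ a₁ b),
    Q1Row_root' p ends o a₁ a₂ b⟩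

/-- **The triple at every marked vertex `x ∈ {o, b, a₁, a₂}`.** -/
theorem HCovTriple_marked (hp : IsProbVec p) {x o a₁ a₂ b : V}
    (hx : x = o ∨ x = b ∨ x = a₁ ∨ x = a₂) : HCovTriple p ends o a₁ a₂ x b := by
  rcases hx with rfl | rfl | rfl | rfl
  · exact HCovTriple_o p ends hp x a₁ a₂ b
  · exact HCovTriple_b p ends hp o a₁ a₂ x
  · exact HCovTriple_root' p ends hp o x a₂ b
  · exact HCovTriple_root p ends hp o a₁ x b

end LeafStep

end Summit.Ventures.PercRepro2
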